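import Literature.Probability.MarkovChains.OptimalCoupling
import Summits.Ventures.LatticeQCDFlow.Scaling.CompositionDistanceRedraw

/-!
HONEST FRAMING: exact (Metropolis-corrected) sampling algorithms for lattice gauge theory; figures
of merit are autocorrelation/cost numbers at stated couplings and volumes; no continuum-physics
claim.

# CycleEndHubBracket — THE COMPOSITION-DISTANCE BRACKET OF ONE REFRESH CYCLE IS A DIFFERENCE OF ONE-COPY END-HUB LAWS:
# `E[Δ'] = Δ − G` UNDER THE OPTIMAL COUPLING OF THE TWO DELETED CONTENTS, `G = u_X(A) − u_Y(A) − Σ_C (u_Y − u_X)⁺`, AND NO COUPLING DOES BETTER (lean-2 GEN-35, ours)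

Venture-side (OURS).  Cell `lqcd-flow` (pub-lqcd), unit `pub-lqcd-lean-2-g35`, 2026-08-29.  Chapter V (OPEN-MATH-chapterM item 1 (i) at FAST swaps, in
COMPOSITION VARIABLES), file 2.  Setting of file 1 (`CompositionDistanceRedraw`): two full compositions `N_X, N_Y : S → ℕ` (hub included), one deletion each
(contents `a ∼ u_X`, `b ∼ u_Y` — for the homogeneous `q`-content star these are the laws of the hub content at the END of the refresh cycle, one-copy
quantities) and a common insertion; `Δ(N,N') = Σ_v (N(v) − N'(v))⁺`; `A = {N_Y < N_X}`, `B = {N_X < N_Y}`, `C = {N_X = N_Y}`.  File 1 gave, for ANY coupling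
`π` of `(u_X, u_Y)`, `E_π[Δ(survivors)] = Δ(N_X,N_Y) − u_X(A) + u_Y(Bᶜ) − Σ_{c ∈ C} π(c,c)`.  Here: the diagonal of a coupling is at most `u_X ∧ u_Y`, so EVERY
coupling has `E_π[Δ'] ≥ Δ − G` with `G = u_X(A) − u_Y(Bᶜ) + Σ_C (u_X ∧ u_Y) = u_X(A) − u_Y(A) − Σ_C (u_Y − u_X)⁺`, and the tree's optimal coupling
(`Literature.…​.optimalCoupling`, LPW Prop. 4.7 / Remark 4.8, diagonal `= u_X ∧ u_Y`) attains `E[Δ'] = Δ − G`: the best one-cycle contraction of the composition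
distance is an explicit functional of the two ONE-COPY end-hub laws — the `q ≥ 3`, any-swap-rate analogue of chapter S's «bracket = difference of one-copy
drifts».  Also: under the optimal coupling the off-diagonal mass sits on `{u_Y < u_X} × {u_X < u_Y}`, so if `u_Y(a) < u_X(a)` forces `a ∈ A` (or `u_X(b) < u_Y(b)`
forces `b ∈ B`) the distance NEVER increases (file 3 verifies this for the `τ = ∞` urn).  Hypothesis-equations (`hΔ`, survivors `hMX`, `hMY`), no definitions.

## What is proved

* §1 `coupling_diag_le_min` (`π(c,c) ≤ u_X(c) ∧ u_Y(c)` for any coupling), `optimalCoupling_offDiag_support` (`q(a,b) ≠ 0`, `a ≠ b ⇒ u_Y(a) < u_X(a) ∧ u_X(b) < u_Y(b)`).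
* §2 the three forms of the gain: `hubGain_eq_posPart` (`u_X(A) − u_Y(Bᶜ) + Σ_C u_X ∧ u_Y = u_X(A) − u_Y(A) − Σ_C (u_Y − u_X)⁺`, no hypothesis),
  `hubGain_eq_posPart'` (`= u_Y(B) − u_X(B) − Σ_C (u_X − u_Y)⁺`, equal masses), `hubGain_eq_half` (`= ½[u_X(A) − u_Y(A) + u_Y(B) − u_X(B) − Σ_C |u_X − u_Y|]`).
* §3 **`hubBracket_eq`** (file 1 §4 for an `IsCoupling`), **`hubBracket_ge`** (EVERY coupling: `E_π[Δ'] ≥ Δ − G`), **`hubBracket_optimal`** (the optimal coupling: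
  `E[Δ'] = Δ − G`).
* §4 **`hubBracket_monotone_of_A`** ∕ **`hubBracket_monotone_of_B`** — pointwise monotonicity on the support of the optimal coupling under the one-copy
  hypothesis `u_Y(a) < u_X(a) ⇒ a ∈ A` (resp. `u_X(b) < u_Y(b) ⇒ b ∈ B`), and `hubBracket_optimal_le_of_A` ∕ `_of_B` (`E[Δ'] ≤ Δ` then).

Reading (no numerics implied): the composition distance of the two copies of the star changes only at redraws; coupling the two cycle-END hub contents optimally
(a cycle-to-cycle Markovian coupling of the lumped chain — no path coupling inside the cycle is involved) gives the one-cycle drift `−G(u_x, u_y)` where `u_x` is the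
law of the hub content at the end of the cycle started from the lumped state `x`; a certificate for item 1 (i) at any swap rate is therefore a ONE-COPY estimate of
`u_x` plus a one-copy environment potential.  NOT CLAIMED: any estimate of `u_x` at finite swap odds (file 3 does `τ = ∞`); anything measured.  Literature grade
(cell rule): OWN, elementary, on the tree's LPW Prop. 4.7 file; nothing cited as a fact; no new bib keys.
-/

open Finset
open Literature.Probability.MarkovChains

namespace Summit.Ventures.LatticeQCDFlow.Scaling

section Bracket
variable {S : Type*} [Fintype S] [DecidableEq S] {Δ : (S → ℕ) → (S → ℕ) → ℕ}

/-! ## §1 Diagonal and off-diagonal of couplings -/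

omit [DecidableEq S] in
/-- The diagonal of any coupling is dominated by both marginals: `π(c,c) ≤ u_X(c) ∧ u_Y(c)`. [ours] -/
theorem coupling_diag_le_min {uX uY : S → ℝ} {π : S → S → ℝ} (hπ : IsCoupling uX uY π) (c : S) :
    π c c ≤ min (uX c) (uY c) := by
  obtain ⟨h0, hr, hc⟩ := hπ
  refine le_min ?_ ?_
  · rw [← hr c]; exact single_le_sum (f := fun b => π c b) (fun b _ => h0 c b) (mem_univ c)
  · rw [← hc c]; exact single_le_sum (f := fun a => π a c) (fun a _ => h0 a c) (mem_univ c)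

/-- **Off-diagonal support of the optimal coupling:** `q(a,b) ≠ 0` with `a ≠ b` forces `u_Y(a) < u_X(a)` and `u_X(b) < u_Y(b)` (the residuals `(u_X − u_Y)⁺`,
`(u_Y − u_X)⁺` carry the off-diagonal mass). [ours] -/
theorem optimalCoupling_offDiag_support {μ ν : S → ℝ} {a b : S} (hab : a ≠ b) (h : optimalCoupling μ ν a b ≠ 0) :
    ν a < μ a ∧ μ b < ν b := by
  rw [optimalCoupling_of_ne μ ν hab] at h
  have h1 : μ a - min (μ a) (ν a) ≠ 0 := by intro e; apply h; rw [e, zero_mul, zero_div]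
  have h2 : ν b - min (μ b) (ν b) ≠ 0 := by intro e; apply h; rw [e, mul_zero, zero_div]
  constructor
  · by_contra hle
    exact h1 (by rw [min_eq_left (not_lt.mp hle), sub_self])
  · by_contra hle
    exact h2 (by rw [min_eq_right (not_lt.mp hle), sub_self])

/-! ## §2 The three forms of the gain `G` -/

omit [DecidableEq S] in
/-- **`u_X(A) − u_Y(Bᶜ) + Σ_C (u_X ∧ u_Y) = u_X(A) − u_Y(A) − Σ_C (u_Y − u_X)⁺`** (no hypothesis; `Bᶜ = A ∪ C`, `u ∧ u' = u' − (u' − u)⁺`). [ours] -/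
theorem hubGain_eq_posPart (NX NY : S → ℕ) (uX uY : S → ℝ) :
    ∑ v, uX v * (if NY v < NX v then (1 : ℝ) else 0) - ∑ v, uY v * (if NY v ≤ NX v then (1 : ℝ) else 0)
        + ∑ v, min (uX v) (uY v) * (if NX v = NY v then (1 : ℝ) else 0)
      = ∑ v, uX v * (if NY v < NX v then (1 : ℝ) else 0) - ∑ v, uY v * (if NY v < NX v then (1 : ℝ) else 0)
        - ∑ v, max (uY v - uX v) 0 * (if NX v = NY v then (1 : ℝ) else 0) := by
  have hpt : ∀ v, uX v * (if NY v < NX v then (1 : ℝ) else 0) - uY v * (if NY v ≤ NX v then (1 : ℝ) else 0)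
        + min (uX v) (uY v) * (if NX v = NY v then (1 : ℝ) else 0)
      = uX v * (if NY v < NX v then (1 : ℝ) else 0) - uY v * (if NY v < NX v then (1 : ℝ) else 0)
        - max (uY v - uX v) 0 * (if NX v = NY v then (1 : ℝ) else 0) := by
    intro v
    rcases lt_trichotomy (NY v) (NX v) with h | h | h
    · rw [if_pos h, if_pos h.le, if_neg (ne_of_gt h)]; ring
    · rw [if_neg (by rw [h]; exact lt_irrefl _), if_pos h.le, if_pos h.symm]
      rcases le_total (uX v) (uY v) with k | k
      · rw [min_eq_left k, max_eq_left (sub_nonneg.mpr k)]; ring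
      · rw [min_eq_right k, max_eq_right (sub_nonpos.mpr k)]; ring
    · rw [if_neg (not_lt.mpr h.le), if_neg (not_le.mpr h), if_neg (ne_of_lt h)]; ring
  have := Finset.sum_congr rfl fun v (_ : v ∈ (univ : Finset S)) => hpt v
  rw [sum_sub_distrib, sum_add_distrib, sum_sub_distrib, sum_sub_distrib] at this
  linarith

omit [DecidableEq S] in
/-- **Equal masses ⇒ `u_X(A) − u_Y(A) − Σ_C (u_Y − u_X)⁺ = u_Y(B) − u_X(B) − Σ_C (u_X − u_Y)⁺`** (the gain is symmetric in the roles of the two copies). [ours] -/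
theorem hubGain_eq_posPart' (NX NY : S → ℕ) {uX uY : S → ℝ} (hmass : ∑ v, uX v = ∑ v, uY v) :
    ∑ v, uX v * (if NY v < NX v then (1 : ℝ) else 0) - ∑ v, uY v * (if NY v < NX v then (1 : ℝ) else 0)
        - ∑ v, max (uY v - uX v) 0 * (if NX v = NY v then (1 : ℝ) else 0)
      = ∑ v, uY v * (if NX v < NY v then (1 : ℝ) else 0) - ∑ v, uX v * (if NX v < NY v then (1 : ℝ) else 0)
        - ∑ v, max (uX v - uY v) 0 * (if NX v = NY v then (1 : ℝ) else 0) := by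
  have hpt : ∀ v, (uX v * (if NY v < NX v then (1 : ℝ) else 0) - uY v * (if NY v < NX v then (1 : ℝ) else 0)
        - max (uY v - uX v) 0 * (if NX v = NY v then (1 : ℝ) else 0))
      - (uY v * (if NX v < NY v then (1 : ℝ) else 0) - uX v * (if NX v < NY v then (1 : ℝ) else 0)
        - max (uX v - uY v) 0 * (if NX v = NY v then (1 : ℝ) else 0)) = uX v - uY v := by
    intro v
    rcases lt_trichotomy (NY v) (NX v) with h | h | h
    · rw [if_pos h, if_neg (ne_of_gt h), if_neg (not_lt.mpr h.le)]; ring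
    · rw [if_neg (by rw [h]; exact lt_irrefl _), if_pos h.symm, if_neg (by rw [h]; exact lt_irrefl _)]
      rcases le_total (uX v) (uY v) with k | k
      · rw [max_eq_left (sub_nonneg.mpr k), max_eq_right (sub_nonpos.mpr k)]; ring
      · rw [max_eq_right (sub_nonpos.mpr k), max_eq_left (sub_nonneg.mpr k)]; ring
    · rw [if_neg (not_lt.mpr h.le), if_neg (ne_of_lt h), if_pos h]; ring
  have hs := Finset.sum_congr rfl fun v (_ : v ∈ (univ : Finset S)) => hpt v
  rw [sum_sub_distrib, sum_sub_distrib, sum_sub_distrib, sum_sub_distrib, sum_sub_distrib, sum_sub_distrib, hmass, sub_self] at hs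
  linarith

omit [DecidableEq S] in
/-- **Equal masses ⇒ `G = ½[u_X(A) − u_Y(A) + u_Y(B) − u_X(B) − Σ_C |u_X − u_Y|]`** (`t⁺ + (−t)⁺ = |t|`). [ours] -/
theorem hubGain_eq_half (NX NY : S → ℕ) {uX uY : S → ℝ} (hmass : ∑ v, uX v = ∑ v, uY v) :
    ∑ v, uX v * (if NY v < NX v then (1 : ℝ) else 0) - ∑ v, uY v * (if NY v < NX v then (1 : ℝ) else 0)
        - ∑ v, max (uY v - uX v) 0 * (if NX v = NY v then (1 : ℝ) else 0)
      = (1 / 2) * (∑ v, uX v * (if NY v < NX v then (1 : ℝ) else 0) - ∑ v, uY v * (if NY v < NX v then (1 : ℝ) else 0)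
          + ∑ v, uY v * (if NX v < NY v then (1 : ℝ) else 0) - ∑ v, uX v * (if NX v < NY v then (1 : ℝ) else 0)
          - ∑ v, |uX v - uY v| * (if NX v = NY v then (1 : ℝ) else 0)) := by
  have h := hubGain_eq_posPart' NX NY hmass
  have habs : ∑ v, |uX v - uY v| * (if NX v = NY v then (1 : ℝ) else 0)
      = ∑ v, max (uY v - uX v) 0 * (if NX v = NY v then (1 : ℝ) else 0) + ∑ v, max (uX v - uY v) 0 * (if NX v = NY v then (1 : ℝ) else 0) := by
    rw [← sum_add_distrib]
    refine sum_congr rfl fun v _ => ?_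
    rw [← add_mul]
    congr 1
    rcases le_total (uX v) (uY v) with k | k
    · rw [max_eq_left (sub_nonneg.mpr k), max_eq_right (sub_nonpos.mpr k), add_zero, abs_sub_comm, abs_of_nonneg (sub_nonneg.mpr k)]
    · rw [max_eq_right (sub_nonpos.mpr k), max_eq_left (sub_nonneg.mpr k), zero_add, abs_of_nonneg (sub_nonneg.mpr k)]
  rw [habs]
  linarith

/-! ## §3 The bracket: every coupling, and the optimal one -/

/-- **THE BRACKET FOR ANY COUPLING** (file 1 §4 restated for the tree's `IsCoupling`): `E_π[Δ(survivors)] = Δ(N_X,N_Y) − u_X(A) + u_Y(Bᶜ) − Σ_{c ∈ C} π(c,c)`. [ours] -/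
theorem hubBracket_eq (hΔ : ∀ N N', Δ N N' = ∑ v, (N v - N' v)) (NX NY : S → ℕ) (MX MY : S → S → ℕ) {π : S → S → ℝ} {uX uY : S → ℝ}
    (hπ : IsCoupling uX uY π) (htot : ∑ a, uX a = 1)
    (hMX : ∀ a, uX a ≠ 0 → NX = MX a + Pi.single a 1) (hMY : ∀ b, uY b ≠ 0 → NY = MY b + Pi.single b 1) :
    ∑ a, ∑ b, π a b * (Δ (MX a) (MY b) : ℝ)
      = (Δ NX NY : ℝ) - ∑ a, uX a * (if NY a < NX a then (1 : ℝ) else 0) + ∑ b, uY b * (if NY b ≤ NX b then (1 : ℝ) else 0)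
        - ∑ c, π c c * (if NX c = NY c then (1 : ℝ) else 0) :=
  cdist_expect_eq hΔ NX NY MX MY π uX uY hπ.1 hπ.2.1 hπ.2.2 htot hMX hMY

/-- **NO COUPLING BEATS `Δ − G`:** for every coupling `π` of the two deleted contents,
`E_π[Δ(survivors)] ≥ Δ(N_X,N_Y) − [u_X(A) − u_Y(Bᶜ) + Σ_C (u_X ∧ u_Y)]`. [ours] -/
theorem hubBracket_ge (hΔ : ∀ N N', Δ N N' = ∑ v, (N v - N' v)) (NX NY : S → ℕ) (MX MY : S → S → ℕ) {π : S → S → ℝ} {uX uY : S → ℝ}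
    (hπ : IsCoupling uX uY π) (htot : ∑ a, uX a = 1)
    (hMX : ∀ a, uX a ≠ 0 → NX = MX a + Pi.single a 1) (hMY : ∀ b, uY b ≠ 0 → NY = MY b + Pi.single b 1) :
    (Δ NX NY : ℝ) - (∑ v, uX v * (if NY v < NX v then (1 : ℝ) else 0) - ∑ v, uY v * (if NY v ≤ NX v then (1 : ℝ) else 0)
        + ∑ v, min (uX v) (uY v) * (if NX v = NY v then (1 : ℝ) else 0))
      ≤ ∑ a, ∑ b, π a b * (Δ (MX a) (MY b) : ℝ) := by
  rw [hubBracket_eq hΔ NX NY MX MY hπ htot hMX hMY]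
  have hdiag : ∑ c, π c c * (if NX c = NY c then (1 : ℝ) else 0) ≤ ∑ v, min (uX v) (uY v) * (if NX v = NY v then (1 : ℝ) else 0) := by
    refine sum_le_sum fun c _ => ?_
    refine mul_le_mul_of_nonneg_right (coupling_diag_le_min hπ c) ?_
    split_ifs <;> norm_num
  linarith

/-- **THE OPTIMAL COUPLING ATTAINS IT:** with `q = optimalCoupling u_X u_Y` (diagonal `u_X ∧ u_Y`),
`E_q[Δ(survivors)] = Δ(N_X,N_Y) − [u_X(A) − u_Y(Bᶜ) + Σ_C (u_X ∧ u_Y)] = Δ − G`. [ours] -/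
theorem hubBracket_optimal (hΔ : ∀ N N', Δ N N' = ∑ v, (N v - N' v)) (NX NY : S → ℕ) (MX MY : S → S → ℕ) {uX uY : S → ℝ}
    (h0X : ∀ v, 0 ≤ uX v) (h0Y : ∀ v, 0 ≤ uY v) (h1X : ∑ v, uX v = 1) (h1Y : ∑ v, uY v = 1)
    (hMX : ∀ a, uX a ≠ 0 → NX = MX a + Pi.single a 1) (hMY : ∀ b, uY b ≠ 0 → NY = MY b + Pi.single b 1) :
    ∑ a, ∑ b, optimalCoupling uX uY a b * (Δ (MX a) (MY b) : ℝ)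
      = (Δ NX NY : ℝ) - (∑ v, uX v * (if NY v < NX v then (1 : ℝ) else 0) - ∑ v, uY v * (if NY v ≤ NX v then (1 : ℝ) else 0)
        + ∑ v, min (uX v) (uY v) * (if NX v = NY v then (1 : ℝ) else 0)) := by
  rw [hubBracket_eq hΔ NX NY MX MY (optimalCoupling_isCoupling h0X h0Y h1X h1Y) h1X hMX hMY]
  simp_rw [optimalCoupling_self]
  ring

/-- The same with the gain in the form `u_X(A) − u_Y(A) − Σ_C (u_Y − u_X)⁺` (the «difference of one-copy laws» reading). [ours] -/
theorem hubBracket_optimal' (hΔ : ∀ N N', Δ N N' = ∑ v, (N v - N' v)) (NX NY : S → ℕ) (MX MY : S → S → ℕ) {uX uY : S → ℝ}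
    (h0X : ∀ v, 0 ≤ uX v) (h0Y : ∀ v, 0 ≤ uY v) (h1X : ∑ v, uX v = 1) (h1Y : ∑ v, uY v = 1)
    (hMX : ∀ a, uX a ≠ 0 → NX = MX a + Pi.single a 1) (hMY : ∀ b, uY b ≠ 0 → NY = MY b + Pi.single b 1) :
    ∑ a, ∑ b, optimalCoupling uX uY a b * (Δ (MX a) (MY b) : ℝ)
      = (Δ NX NY : ℝ) - (∑ v, uX v * (if NY v < NX v then (1 : ℝ) else 0) - ∑ v, uY v * (if NY v < NX v then (1 : ℝ) else 0)
        - ∑ v, max (uY v - uX v) 0 * (if NX v = NY v then (1 : ℝ) else 0)) := by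
  rw [hubBracket_optimal hΔ NX NY MX MY h0X h0Y h1X h1Y hMX hMY, hubGain_eq_posPart]

/-! ## §4 Monotonicity on the support of the optimal coupling -/

/-- **If `u_Y(a) < u_X(a)` forces `a ∈ A`, the distance never increases under the optimal coupling** (pointwise on its support). [ours] -/
theorem hubBracket_monotone_of_A (hΔ : ∀ N N', Δ N N' = ∑ v, (N v - N' v)) (NX NY : S → ℕ) (MX MY : S → S → ℕ) {uX uY : S → ℝ}
    (h0X : ∀ v, 0 ≤ uX v) (h0Y : ∀ v, 0 ≤ uY v)
    (hMX : ∀ a, uX a ≠ 0 → NX = MX a + Pi.single a 1) (hMY : ∀ b, uY b ≠ 0 → NY = MY b + Pi.single b 1)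
    (hA : ∀ a, uY a < uX a → NY a < NX a) {a b : S} (hq : optimalCoupling uX uY a b ≠ 0) :
    Δ (MX a) (MY b) ≤ Δ NX NY := by
  by_cases hab : a = b
  · subst hab
    rw [optimalCoupling_self] at hq
    have hXa : uX a ≠ 0 := fun e => hq (by rw [e, min_eq_left (h0Y a)])
    have hYa : uY a ≠ 0 := fun e => hq (by rw [e, min_eq_right (h0X a)])
    rw [hMX a hXa, hMY a hYa, cdist_add_single_same hΔ]
  · obtain ⟨h1, h2⟩ := optimalCoupling_offDiag_support hab hq
    have hXa : uX a ≠ 0 := ne_of_gt (lt_of_le_of_lt (h0Y a) h1)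
    have hYb : uY b ≠ 0 := ne_of_gt (lt_of_le_of_lt (h0X b) h2)
    have hX := hMX a hXa
    have hY := hMY b hYb
    have hAa := hA a h1
    rw [hX, hY] at hAa ⊢
    have e1 : (MX a + Pi.single a 1 : S → ℕ) a = MX a a + 1 := by simp
    have e2 : (MY b + Pi.single b 1 : S → ℕ) a = MY b a := by simp [hab]
    rw [e1, e2] at hAa
    exact cdist_survivors_le_of_mem hΔ (MX a) (MY b) b (by omega)

/-- **If `u_X(b) < u_Y(b)` forces `b ∈ B`, the distance never increases under the optimal coupling** (pointwise on its support). [ours] -/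
theorem hubBracket_monotone_of_B (hΔ : ∀ N N', Δ N N' = ∑ v, (N v - N' v)) (NX NY : S → ℕ) (MX MY : S → S → ℕ) {uX uY : S → ℝ}
    (h0X : ∀ v, 0 ≤ uX v) (h0Y : ∀ v, 0 ≤ uY v)
    (hMX : ∀ a, uX a ≠ 0 → NX = MX a + Pi.single a 1) (hMY : ∀ b, uY b ≠ 0 → NY = MY b + Pi.single b 1)
    (hB : ∀ b, uX b < uY b → NX b < NY b) {a b : S} (hq : optimalCoupling uX uY a b ≠ 0) :
    Δ (MX a) (MY b) ≤ Δ NX NY := by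
  by_cases hab : a = b
  · subst hab
    rw [optimalCoupling_self] at hq
    have hXa : uX a ≠ 0 := fun e => hq (by rw [e, min_eq_left (h0Y a)])
    have hYa : uY a ≠ 0 := fun e => hq (by rw [e, min_eq_right (h0X a)])
    rw [hMX a hXa, hMY a hYa, cdist_add_single_same hΔ]
  · obtain ⟨h1, h2⟩ := optimalCoupling_offDiag_support hab hq
    have hXa : uX a ≠ 0 := ne_of_gt (lt_of_le_of_lt (h0Y a) h1)
    have hYb : uY b ≠ 0 := ne_of_gt (lt_of_le_of_lt (h0X b) h2)
    have hX := hMX a hXa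
    have hY := hMY b hYb
    have hBb := hB b h2
    rw [hX, hY] at hBb ⊢
    have e1 : (MX a + Pi.single a 1 : S → ℕ) b = MX a b := by simp [Ne.symm hab]
    have e2 : (MY b + Pi.single b 1 : S → ℕ) b = MY b b + 1 := by simp
    rw [e1, e2] at hBb
    exact cdist_survivors_le_of_mem' hΔ (MX a) (MY b) a (by omega)

/-- Under the hypothesis of `hubBracket_monotone_of_A` the optimal coupling has `E[Δ(survivors)] ≤ Δ(N_X,N_Y)`, i.e. `G ≥ 0`. [ours] -/
theorem hubBracket_optimal_le_of_A (hΔ : ∀ N N', Δ N N' = ∑ v, (N v - N' v)) (NX NY : S → ℕ) (MX MY : S → S → ℕ) {uX uY : S → ℝ}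
    (h0X : ∀ v, 0 ≤ uX v) (h0Y : ∀ v, 0 ≤ uY v) (h1X : ∑ v, uX v = 1) (h1Y : ∑ v, uY v = 1)
    (hMX : ∀ a, uX a ≠ 0 → NX = MX a + Pi.single a 1) (hMY : ∀ b, uY b ≠ 0 → NY = MY b + Pi.single b 1)
    (hA : ∀ a, uY a < uX a → NY a < NX a) :
    ∑ a, ∑ b, optimalCoupling uX uY a b * (Δ (MX a) (MY b) : ℝ) ≤ (Δ NX NY : ℝ) := by
  have hq := optimalCoupling_isCoupling h0X h0Y h1X h1Y
  calc ∑ a, ∑ b, optimalCoupling uX uY a b * (Δ (MX a) (MY b) : ℝ)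
      ≤ ∑ a, ∑ b, optimalCoupling uX uY a b * (Δ NX NY : ℝ) := by
        refine sum_le_sum fun a _ => sum_le_sum fun b _ => ?_
        by_cases hz : optimalCoupling uX uY a b = 0
        · rw [hz, zero_mul, zero_mul]
        · exact mul_le_mul_of_nonneg_left (by exact_mod_cast hubBracket_monotone_of_A hΔ NX NY MX MY h0X h0Y hMX hMY hA hz) (hq.1 a b)
    _ = (Δ NX NY : ℝ) := by
        simp_rw [← sum_mul]
        have : ∑ a, ∑ b, optimalCoupling uX uY a b = 1 := by simp_rw [hq.2.1]; exact h1X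
        rw [this, one_mul]

/-- Under the hypothesis of `hubBracket_monotone_of_B` the optimal coupling has `E[Δ(survivors)] ≤ Δ(N_X,N_Y)`. [ours] -/
theorem hubBracket_optimal_le_of_B (hΔ : ∀ N N', Δ N N' = ∑ v, (N v - N' v)) (NX NY : S → ℕ) (MX MY : S → S → ℕ) {uX uY : S → ℝ}
    (h0X : ∀ v, 0 ≤ uX v) (h0Y : ∀ v, 0 ≤ uY v) (h1X : ∑ v, uX v = 1) (h1Y : ∑ v, uY v = 1)
    (hMX : ∀ a, uX a ≠ 0 → NX = MX a + Pi.single a 1) (hMY : ∀ b, uY b ≠ 0 → NY = MY b + Pi.single b 1)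
    (hB : ∀ b, uX b < uY b → NX b < NY b) :
    ∑ a, ∑ b, optimalCoupling uX uY a b * (Δ (MX a) (MY b) : ℝ) ≤ (Δ NX NY : ℝ) := by
  have hq := optimalCoupling_isCoupling h0X h0Y h1X h1Y
  calc ∑ a, ∑ b, optimalCoupling uX uY a b * (Δ (MX a) (MY b) : ℝ)
      ≤ ∑ a, ∑ b, optimalCoupling uX uY a b * (Δ NX NY : ℝ) := by
        refine sum_le_sum fun a _ => sum_le_sum fun b _ => ?_
        by_cases hz : optimalCoupling uX uY a b = 0
        · rw [hz, zero_mul, zero_mul]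
        · exact mul_le_mul_of_nonneg_left (by exact_mod_cast hubBracket_monotone_of_B hΔ NX NY MX MY h0X h0Y hMX hMY hB hz) (hq.1 a b)
    _ = (Δ NX NY : ℝ) := by
        simp_rw [← sum_mul]
        have : ∑ a, ∑ b, optimalCoupling uX uY a b = 1 := by simp_rw [hq.2.1]; exact h1X
        rw [this, one_mul]

end Bracket

end Summit.Ventures.LatticeQCDFlow.Scaling
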